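import Summits.AtomisticToContinuum.HydrodynamicLimit.Theses.OneFlightGossipEngine
import Summits.AtomisticToContinuum.HydrodynamicLimit.Theorems.OneFlightGossipEngineClampedCurrentsDockFreezeToolkit
import Summits.AtomisticToContinuum.HydrodynamicLimit.Theorems.ImplosionDichotomyHydroLimitInBandWindowContinuityFields
import Literature.Analysis.FluidPDE.CollisionalTransfer
import Literature.MathematicalPhysics.KineticTheory.HardSphereEulerProofs
import HarnessLib

/-!
# Flow shift of window functionals and freeze bounds (stub `stub_flowShiftFreeze`, line `IdeatorTwoSketch`,
# crux `ClampedCurrentsDock`, stmt-AtomisticToContinuum-14680)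

Support file (`--supports stmt-AtomisticToContinuum-14680`) proving the registered stub FS+FZ
`stub_flowShiftFreeze : WindowFlowShift ∧ FreezeBounds` of the lead's skeleton
(`Cruxes/ClampedCurrentsDock/Lines/IdeatorTwoSketch.lean`, §1d; the two `def`s below are verbatim copies).

* FS (`windowFlowShift`): on the good set, `∫_s^{s+w} f(Φ_r z) dr = ∫_0^w f(Φ_r(Φ_s z)) dr` (change of variables
  `r ↦ r + s` and the group law `Φ_{r+s} = Φ_r ∘ Φ_s`, `HardSphereFlow.flow_add`) and, for record functionals read
  modulo the time stamp, `collisionSum_{(s,s+w]} (F ∘ shift_s) z = collisionSum_{(0,w]} F (Φ_s z)`: the orbit of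
  `Φ_s z` is the time shift of the orbit of `z`, its collision times are the shifted ones (definitionally, cf.
  `collisionalTransfer_comp_add_right`), the contact pairs at corresponding times coincide, and the record
  `HardSphereCollisionRecord.ofConfig` sees the time only through its `time` field; reindex the `finsum` along
  `r ↦ r + s` (`finsum_mem_eq_of_bijOn`), as in `EnergyCurrentTailsLevelCensus.collisionSum_Ioc_eq_collisionSum_flow`.
* FZ (`freezeBounds`): slab calculus on a classical solution in band with an analytic EOS window, with the toolkit
  `ClampedCurrentsDockFreezeToolkit`: the fast kinetic functional of S8 lies in the weighted time-Lipschitz class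
  `WLip t 3` and the EOS-projection integrand in `WLip t 2` (closure of the class under the algebra; the coefficient
  fields `θ⁻¹, ∂u, ∂θ, θ, ρσ³, Z(ρσ³), Z′(ρσ³), Σ∂(u/θ), (u·∇θ)/θ²` are jointly smooth on `[0,t] × 𝕋³`, the
  compressibility factor `Z = hsCompressibility` being smooth on the EOS window `(0, η₁)`, which contains the packing
  range by the guard `ρσ³ < η₁/2`); the two pair-kernel clauses are the mixed bound `exists_mixed_lipschitz` and the
  two spatial clauses the bound `exists_spatial_lipschitz`, for the test functions `u_k/θ` and `∓θ⁻¹`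
  (`HydroLimitInBandContinuity.isSmoothSpaceTimeOn_momPart/inv`).

prover-line-stmt-AtomisticToContinuum-14680-c2-0 (stub worker FS+FZ).
-/

noncomputable section

namespace Summit.AtomisticToContinuum.HydrodynamicLimit.Theorems.ClampedCurrentsDockFlowShiftFreeze

open scoped BigOperators ENNReal Classical Interval
open MeasureTheory Filter Set Topology InformationTheory
open Literature.MathematicalPhysics.KineticTheory Literature.Analysis.FluidPDE Literature.Analysis.FunctionSpaces
open Summit.AtomisticToContinuum.HydrodynamicLimit.Theses.OneFlightGossipEngine
open Summit.AtomisticToContinuum.HydrodynamicLimit.Theorems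

/-! ## The statements (verbatim from the line skeleton, §1d) -/

/-- **FS — flow shift of window functionals on the good set (staged; M−).** `∫_s^{s+w} f(Φ_r z) dr = ∫_0^w f(Φ_r(Φ_s z)) dr` and,
for record functionals read modulo the time stamp, `collisionSum_{(s,s+w]} F z = collisionSum_{(0,w]} F (Φ_s z)` (`flow_add`,
time shift of collision times and records as in `collisionalTransfer_comp_add_right`).
Verbatim copy of the first conjunct of the registered stub signature `stub_flowShiftFreeze : WindowFlowShift ∧ FreezeBounds`
(line `IdeatorTwoSketch`, §1d) — route-internal, not a cited fact. -/
def WindowFlowShift : Prop :=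
  ∀ (σ : ℝ) (N : ℕ) (Φ : HardSphereFlow (Torus.geometry (Fin 3)) (hsDiameter σ N) (N + 1)) (s w : ℝ),
    0 ≤ s → 0 ≤ w → ∀ z ∈ Φ.good,
      (∀ f : Config (N + 1) (Fin 3) T3 → ℝ,
          (∫ r in s..(s + w), f (Φ.flow r z)) = ∫ r in (0 : ℝ)..w, f (Φ.flow r (Φ.flow s z))) ∧
      (∀ F : HardSphereCollisionRecord (Fin 3) T3 (N + 1) → ℝ,
          Φ.collisionSum (Set.Ioc s (s + w)) (fun c => F { c with time := c.time - s }) z =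
            Φ.collisionSum (Set.Ioc 0 w) F (Φ.flow s z))

/-- **FZ — FREEZE BOUNDS (staged; M/L, pure calculus on a classical solution in band with an analytic insertion factor):**
time-Lipschitz bounds, uniform on `[0,t] × 𝕋³`, of the fast kinetic functional of S8 (cubic weight `1 + ‖v‖³`), of the
EOS-projection integrand (quadratic weight), of the two test-function differences of the pair kernel at contact scale
(`× euclidDist`), and the SPATIAL Lipschitz bounds of the two test functions uniformly in time (torus mean value inequality). Tools: the slab lemmas `exists_lipschitz_slab` / `exists_deriv_bound_slab` of the 9133 Fields file.
Verbatim copy of the second conjunct of the registered stub signature `stub_flowShiftFreeze : WindowFlowShift ∧ FreezeBounds`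
(line `IdeatorTwoSketch`, §1d) — route-internal, not a cited fact. -/
def FreezeBounds : Prop :=
  ∀ (σ T : ℝ) (ρ θ : ℝ → T3 → ℝ) (u : ℝ → T3 → V3) (η₁ : ℝ) (F : ℝ → ℝ),
    IsHardSphereEulerSolution σ T ρ u θ → 0 < σ → 0 < η₁ → AnalyticOnNhd ℝ F (Ioo (-η₁) η₁) →
    (∀ η ∈ Ioo 0 η₁, hsCompressibility η = 1 + η * deriv F η) →
    ∀ t ∈ Ioo 0 T, (∀ s ∈ Icc 0 t, ∀ x, ρ s x * σ ^ 3 < η₁ / 2) →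
      ∃ C : ℝ, 0 ≤ C ∧ ∀ s₁ ∈ Icc 0 t, ∀ s₂ ∈ Icc 0 t, ∀ (x : T3) (v : V3),
        (let fast := fun (s : ℝ) (y : T3 × V3) =>
           (θ s y.1)⁻¹ * ∑ j : Fin 3, ∑ k : Fin 3,
               ((y.2 - u s y.1) j * (y.2 - u s y.1) k - (if j = k then ‖y.2 - u s y.1‖ ^ 2 / 3 else 0)) *
                 Torus.partialDeriv k (fun x => u s x j) y.1 +
             (‖y.2 - u s y.1‖ ^ 2 - 5 * θ s y.1) * (∑ k : Fin 3, (y.2 - u s y.1) k * Torus.partialDeriv k (θ s) y.1) /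
               (2 * (θ s y.1) ^ 2)
         let P := fun (s : ℝ) (y : T3 × V3) =>
           (∑ k : Fin 3, Torus.partialDeriv k (fun x => u s x k / θ s x) y.1) *
             (θ s y.1 * (ρ s y.1 * σ ^ 3) * deriv hsCompressibility (ρ s y.1 * σ ^ 3) +
               (1 / 3) * (hsCompressibility (ρ s y.1 * σ ^ 3) - 1) * ‖y.2 - u s y.1‖ ^ 2) +
           ((∑ k : Fin 3, u s y.1 k * Torus.partialDeriv k (θ s) y.1) / (θ s y.1) ^ 2) *
             (θ s y.1 * (ρ s y.1 * σ ^ 3) * deriv hsCompressibility (ρ s y.1 * σ ^ 3) +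
               (1 / 3) * (hsCompressibility (ρ s y.1 * σ ^ 3) - 1) * ‖y.2 - u s y.1‖ ^ 2) +
           (hsCompressibility (ρ s y.1 * σ ^ 3) - 1) *
             (∑ k : Fin 3, (y.2 - u s y.1) k * Torus.partialDeriv k (θ s) y.1) / θ s y.1
         |fast s₁ (x, v) - fast s₂ (x, v)| ≤ C * |s₁ - s₂| * (1 + ‖v‖ ^ 3) ∧
         |P s₁ (x, v) - P s₂ (x, v)| ≤ C * |s₁ - s₂| * (1 + ‖v‖ ^ 2) ∧
         (∀ (k : Fin 3) (x' : T3),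
            |(u s₁ x k / θ s₁ x - u s₁ x' k / θ s₁ x') - (u s₂ x k / θ s₂ x - u s₂ x' k / θ s₂ x')| ≤
              C * |s₁ - s₂| * Torus.euclidDist x x') ∧
         (∀ x' : T3, |((θ s₁ x)⁻¹ - (θ s₁ x')⁻¹) - ((θ s₂ x)⁻¹ - (θ s₂ x')⁻¹)| ≤ C * |s₁ - s₂| * Torus.euclidDist x x') ∧
         (∀ (k : Fin 3) (x' : T3), |u s₁ x k / θ s₁ x - u s₁ x' k / θ s₁ x'| ≤ C * Torus.euclidDist x x') ∧
         (∀ x' : T3, |(-(θ s₁ x)⁻¹) - (-(θ s₁ x')⁻¹)| ≤ C * Torus.euclidDist x x'))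
/-! ## FS — flow shift of window functionals on the good set -/

section FlowShift

variable {σ : ℝ} {N : ℕ}

/-- **Time integrals over a shifted window.** Along the orbit of `z ∈ good`, the time integral of a one-body
functional over `(s, s + w]` is the time integral over `(0, w]` along the orbit of `Φ_s z` (change of variables
`r ↦ r + s`, `intervalIntegral.integral_comp_add_right`, and the group law `Φ_{r+s} z = Φ_r (Φ_s z)`). [folklore] -/
theorem integral_window_shift (Φ : HardSphereFlow (Torus.geometry (Fin 3)) (hsDiameter σ N) (N + 1))
    {z : Config (N + 1) (Fin 3) T3} (hz : z ∈ Φ.good) (s w : ℝ) (f : Config (N + 1) (Fin 3) T3 → ℝ) :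
    (∫ r in s..(s + w), f (Φ.flow r z)) = ∫ r in (0 : ℝ)..w, f (Φ.flow r (Φ.flow s z)) := by
  have hfa : ∀ r, Φ.flow r (Φ.flow s z) = Φ.flow (r + s) z := fun r => (Φ.flow_add r s z hz).symm
  simp_rw [hfa]
  rw [intervalIntegral.integral_comp_add_right (fun r => f (Φ.flow r z)) s, zero_add, add_comm w s]

/-- **Collision sums over a shifted window.** Along the orbit of `z ∈ good`, the collision sum over `(s, s + w]` of
a record functional PRE-COMPOSED with the time shift `c ↦ {c with time := c.time − s}` is the collision sum over
`(0, w]` of the functional along the orbit of `Φ_s z`: the latter orbit is `r ↦ Φ_{r+s} z` (group law), its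
collision times are `{r | r + s ∈ collisionTimes}` (definitionally), the contact pairs at corresponding times are
the same configuration's, and the record `ofConfig` reads the time only into its `time` field; reindex the finite
sum along `r ↦ r + s` (`finsum_mem_eq_of_bijOn`). [folklore] -/
theorem collisionSum_window_shift (Φ : HardSphereFlow (Torus.geometry (Fin 3)) (hsDiameter σ N) (N + 1))
    {z : Config (N + 1) (Fin 3) T3} (hz : z ∈ Φ.good) (s w : ℝ)
    (F : HardSphereCollisionRecord (Fin 3) T3 (N + 1) → ℝ) :
    Φ.collisionSum (Set.Ioc s (s + w)) (fun c => F { c with time := c.time - s }) z =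
      Φ.collisionSum (Set.Ioc 0 w) F (Φ.flow s z) := by
  rw [HardSphereFlow.collisionSum_eq, HardSphereFlow.collisionSum_eq, collisionSum_eq_collisionPairSum,
    collisionSum_eq_collisionPairSum]
  have hfa : ∀ r, Φ.flow r (Φ.flow s z) = Φ.flow (r + s) z := fun r => (Φ.flow_add r s z hz).symm
  simp only [hfa]
  unfold collisionPairSum
  symm
  refine finsum_mem_eq_of_bijOn (fun r => r + s) ⟨?_, ?_, ?_⟩ fun r _ => ?_
  · rintro r ⟨hr, h0, hr'⟩
    exact ⟨hr, by linarith, by linarith⟩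
  · exact fun r _ r' _ hrr' => by simpa using hrr'
  · rintro r ⟨hr, hrs, hrs'⟩
    refine ⟨r - s, ⟨?_, by linarith, by linarith⟩, sub_add_cancel r s⟩
    show r - s + s ∈ collisionTimes (Torus.geometry (Fin 3)) (hsDiameter σ N) fun t => Φ.flow t z
    rwa [sub_add_cancel]
  · refine Finset.sum_congr rfl fun p _ => ?_
    simp only [HardSphereCollisionRecord.ofConfig, add_sub_cancel_right]

end FlowShift

/-- **FS — flow shift of window functionals on the good set** (first conjunct of the stub). [folklore] -/
theorem windowFlowShift : WindowFlowShift := fun _ _ Φ s w _ _ _ hz =>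
  ⟨fun f => integral_window_shift Φ hz s w f, fun F => collisionSum_window_shift Φ hz s w F⟩

/-! ## FZ — freeze bounds -/

open ClampedCurrentsDockFreezeToolkit HydroLimitInBandContinuity in
/-- **FZ — freeze bounds** (second conjunct of the stub): time-Lipschitz bounds, uniform on `[0, t] × 𝕋³`, of the
fast kinetic functional (cubic weight) and of the EOS-projection integrand (quadratic weight), the mixed
time–space bounds of the two test-function differences, and the spatial Lipschitz bounds of the two test
functions. [folklore] -/
theorem freezeBounds : FreezeBounds := by
  intro σ T ρ θ u η₁ F hE hσ hη₁ hF hZ t ht hguard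
  obtain ⟨ht0, htT⟩ := ht
  have hsub : Icc 0 t ⊆ Ico 0 T := Icc_subset_Ico_right htT
  have hU : UniqueDiffOn ℝ (Icc (0 : ℝ) t) := uniqueDiffOn_Icc ht0
  -- the Euler fields on the compact slab `[0, t] × 𝕋³`
  have hρ : Torus.IsSmoothSpaceTimeOn (Icc 0 t) ρ := hE.smooth_density.mono hsub
  have hu : Torus.IsSmoothSpaceTimeOn (Icc 0 t) u := hE.smooth_velocity.mono hsub
  have hθ : Torus.IsSmoothSpaceTimeOn (Icc 0 t) θ := hE.smooth_temperature.mono hsub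
  have hθ0 : ∀ s ∈ Icc (0 : ℝ) t, ∀ x, θ s x ≠ 0 := fun s hs x => (hE.temperature_pos s (hsub hs) x).ne'
  have hpack : ∀ s ∈ Icc (0 : ℝ) t, ∀ x, ρ s x * σ ^ 3 ∈ Ioo 0 η₁ := fun s hs x =>
    ⟨mul_pos (hE.density_pos s (hsub hs) x) (pow_pos hσ 3), by linarith [hguard s hs x]⟩
  obtain ⟨hZs, hZ's⟩ := sst_hsCompressibility_comp hF hZ hρ hpack
  -- the coefficient fields, as weight-`0` members of the time-Lipschitz class
  let wθ : WLip t 0 fun s x _ => θ s x := WLip.of_smooth ht0 hθ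
  let wθi : WLip t 0 fun s x _ => (θ s x)⁻¹ := WLip.of_smooth ht0 (sst_inv hθ hθ0)
  let wDu : ∀ k j : Fin 3, WLip t 0 fun s x _ => Torus.partialDeriv k (fun x => u s x j) x :=
    fun k j => WLip.of_smooth ht0 ((hu.apply j).partialDeriv hU k)
  let wDθ : ∀ k : Fin 3, WLip t 0 fun s x _ => Torus.partialDeriv k (θ s) x :=
    fun k => WLip.of_smooth ht0 (hθ.partialDeriv hU k)
  let wη : WLip t 0 fun s x _ => ρ s x * σ ^ 3 := WLip.of_smooth ht0 (hρ.mul (sst_const _ (σ ^ 3)))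
  let wZ : WLip t 0 fun s x _ => hsCompressibility (ρ s x * σ ^ 3) := WLip.of_smooth ht0 hZs
  let wZ' : WLip t 0 fun s x _ => deriv hsCompressibility (ρ s x * σ ^ 3) := WLip.of_smooth ht0 hZ's
  let wD : WLip t 0 fun s x _ => ∑ k : Fin 3, Torus.partialDeriv k (fun x => u s x k / θ s x) x :=
    WLip.of_smooth ht0 (Torus.IsSmoothSpaceTimeOn.sum fun k _ => (sst_div (hu.apply k) hθ hθ0).partialDeriv hU k)
  let wQ : WLip t 0 fun s x _ => (∑ k : Fin 3, u s x k * Torus.partialDeriv k (θ s) x) / θ s x ^ 2 :=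
    WLip.of_smooth ht0 (sst_div (Torus.IsSmoothSpaceTimeOn.sum fun k _ => (hu.apply k).mul (hθ.partialDeriv hU k))
      (sst_pow hθ 2) fun s hs x => pow_ne_zero 2 (hθ0 s hs x))
  -- the velocity-dependent building blocks
  let ww : ∀ j : Fin 3, WLip t 1 fun s x v => (v - u s x) j := fun j => WLip.sub_field ht0 hu j
  let wn : WLip t 2 fun s x v => ‖v - u s x‖ ^ 2 := WLip.norm_sub_sq ht0 hu
  -- the fast kinetic functional of S8: weight 3
  let wfast : WLip t 3 fun s x v =>
      (θ s x)⁻¹ * ∑ j : Fin 3, ∑ k : Fin 3,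
          ((v - u s x) j * (v - u s x) k - (if j = k then ‖v - u s x‖ ^ 2 / 3 else 0)) *
            Torus.partialDeriv k (fun x => u s x j) x +
        (‖v - u s x‖ ^ 2 - 5 * θ s x) * (∑ k : Fin 3, (v - u s x) k * Torus.partialDeriv k (θ s) x) /
          (2 * (θ s x) ^ 2) :=
    WLip.add
      (WLip.mul' wθi
        (WLip.sum Finset.univ fun j => WLip.sum Finset.univ fun k =>
          WLip.mul'
            (WLip.sub (WLip.mul' (ww j) (ww k) (le_refl 2))
              (WLip.ite (WLip.div_smooth wn ht0 (sst_const _ 3) fun _ _ _ => three_ne_zero)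
                ((WLip.const t 0).mono (Nat.zero_le 2))))
            (wDu k j) (le_refl 2))
        (by norm_num))
      (WLip.div_smooth
        (WLip.mul' (WLip.sub wn (WLip.mul' (WLip.const t 5) wθ (Nat.zero_le 2)))
          (WLip.sum Finset.univ fun k => WLip.mul' (ww k) (wDθ k) (le_refl 1)) (le_refl 3))
        ht0 ((sst_const _ 2).mul (sst_pow hθ 2))
        fun s hs x => mul_ne_zero two_ne_zero (pow_ne_zero 2 (hθ0 s hs x)))
  -- the EOS-projection integrand: weight 2
  let wB : WLip t 2 fun s x v => θ s x * (ρ s x * σ ^ 3) * deriv hsCompressibility (ρ s x * σ ^ 3) +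
      1 / 3 * (hsCompressibility (ρ s x * σ ^ 3) - 1) * ‖v - u s x‖ ^ 2 :=
    WLip.add ((WLip.mul' (WLip.mul' wθ wη (le_refl 0)) wZ' (Nat.zero_le 2)))
      (WLip.mul' (WLip.mul' (WLip.const t (1 / 3)) (WLip.sub wZ (WLip.const t 1)) (le_refl 0)) wn (le_refl 2))
  let wP : WLip t 2 fun s x v =>
      (∑ k : Fin 3, Torus.partialDeriv k (fun x => u s x k / θ s x) x) *
          (θ s x * (ρ s x * σ ^ 3) * deriv hsCompressibility (ρ s x * σ ^ 3) +
            1 / 3 * (hsCompressibility (ρ s x * σ ^ 3) - 1) * ‖v - u s x‖ ^ 2) +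
        (∑ k : Fin 3, u s x k * Torus.partialDeriv k (θ s) x) / θ s x ^ 2 *
          (θ s x * (ρ s x * σ ^ 3) * deriv hsCompressibility (ρ s x * σ ^ 3) +
            1 / 3 * (hsCompressibility (ρ s x * σ ^ 3) - 1) * ‖v - u s x‖ ^ 2) +
        (hsCompressibility (ρ s x * σ ^ 3) - 1) *
          (∑ k : Fin 3, (v - u s x) k * Torus.partialDeriv k (θ s) x) / θ s x :=
    WLip.add (WLip.add (WLip.mul' wD wB (le_refl 2)) (WLip.mul' wQ wB (le_refl 2)))
      (WLip.div_smooth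
        (WLip.mul' (WLip.sub wZ (WLip.const t 1))
          (WLip.sum Finset.univ fun k => WLip.mul' (ww k) (wDθ k) (le_refl 1)) (Nat.le_succ 1))
        ht0 hθ hθ0)
  -- the test functions `u_k/θ`, `θ⁻¹` on `[0, T) × 𝕋³`: mixed and spatial bounds
  have hmom : ∀ k : Fin 3, Torus.IsSmoothSpaceTimeOn (Ico 0 T) fun s x => u s x k / θ s x := fun k =>
    isSmoothSpaceTimeOn_momPart hE.smooth_temperature hE.smooth_velocity hE.temperature_pos k
  have hinv : Torus.IsSmoothSpaceTimeOn (Ico 0 T) fun s x => (θ s x)⁻¹ :=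
    isSmoothSpaceTimeOn_inv hE.smooth_temperature hE.temperature_pos
  choose K₃ hK₃0 hK₃ using fun k => exists_mixed_lipschitz (hmom k) ht0 htT
  obtain ⟨K₄, hK₄0, hK₄⟩ := exists_mixed_lipschitz hinv ht0 htT
  choose K₅ hK₅0 hK₅ using fun k => exists_spatial_lipschitz (hmom k) ht0 htT
  obtain ⟨K₆, hK₆0, hK₆⟩ := exists_spatial_lipschitz hinv.neg ht0 htT
  -- one constant
  have h₁ := wfast.nonneg
  have h₂ := wP.nonneg
  have hS₃ : ∀ k, K₃ k ≤ ∑ k, K₃ k := fun k => Finset.single_le_sum (fun k _ => hK₃0 k) (Finset.mem_univ k)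
  have hS₅ : ∀ k, K₅ k ≤ ∑ k, K₅ k := fun k => Finset.single_le_sum (fun k _ => hK₅0 k) (Finset.mem_univ k)
  have hS₃0 : 0 ≤ ∑ k, K₃ k := (hK₃0 0).trans (hS₃ 0)
  have hS₅0 : 0 ≤ ∑ k, K₅ k := (hK₅0 0).trans (hS₅ 0)
  refine ⟨4 * wfast.C + 2 * wP.C + ∑ k, K₃ k + K₄ + ∑ k, K₅ k + K₆, by linarith,
    fun s₁ hs₁ s₂ hs₂ x v => ?_⟩
  have hd := euclidDist_nonneg
  dsimp only
  refine ⟨?_, ?_, fun k x' => ?_, fun x' => ?_, fun k x' => ?_, fun x' => ?_⟩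
  · exact le_weight_three (wfast.bound s₁ hs₁ s₂ hs₂ x v).2 h₁ (by linarith) (abs_nonneg _) (norm_nonneg _)
  · exact le_weight_two (wP.bound s₁ hs₁ s₂ hs₂ x v).2 h₂ (by linarith) (abs_nonneg _)
  · exact (hK₃ k s₁ hs₁ s₂ hs₂ x x').trans (mul_le_mul_of_nonneg_right
      (mul_le_mul_of_nonneg_right (by linarith [hS₃ k]) (abs_nonneg _)) (hd x x'))
  · exact (hK₄ s₁ hs₁ s₂ hs₂ x x').trans (mul_le_mul_of_nonneg_right
      (mul_le_mul_of_nonneg_right (by linarith) (abs_nonneg _)) (hd x x'))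
  · exact (hK₅ k s₁ hs₁ x x').trans (mul_le_mul_of_nonneg_right (by linarith [hS₅ k]) (hd x x'))
  · exact (hK₆ s₁ hs₁ x x').trans (mul_le_mul_of_nonneg_right (by linarith) (hd x x'))

/-- **STUB FS+FZ of line `IdeatorTwoSketch`** (registered `stub_flowShiftFreeze : WindowFlowShift ∧ FreezeBounds`):
the flow shift of window functionals on the good set and the freeze bounds of the heart's frozen-coefficient
step. [folklore] -/
theorem stub_flowShiftFreeze : WindowFlowShift ∧ FreezeBounds :=
  ⟨windowFlowShift, freezeBounds⟩

end Summit.AtomisticToContinuum.HydrodynamicLimit.Theorems.ClampedCurrentsDockFlowShiftFreeze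

end
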